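import Summits.CriticalPhenomena.PercolationContinuityZ3.Theorems.PercNearOneGluingNoHeavyLowerTailIncStarTwoCutGlueFX
import Summits.CriticalPhenomena.PercolationContinuityZ3.Theorems.PercNearOneGluingNoHeavyLowerTailIncStarTwoCutFX
import Mathlib.Tactic.LinearCombination
import HarnessLib

/-!
# Two-cuts with the root and one target on the root side (MODE B), XXIV: THEOREM B⁺ — the far side discharged

Support file for the Sahi programme (`--supports stmt-CriticalPhenomena-4575`, prover prim-sahi-p2 gen 28).  No definitions, no named facts,
no sorries; standard axioms PLUS the computational ancestry `Lean.ofReduceBool` of the four checked certificate identities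
(`fx_cert_checkN`, `fy_cert_checkN` of gen 27; `fxForm_checkN`, `fyForm_checkN` of `…IncStarTwoCutFXFormCheck`).
Memo `…/FROM-prim-sahi-p2-gen28-*.md`, PROOF-E3 §37–§38.

`incStar_nonneg_of_twoCut_rootSideTarget_of_FX` (part XIV, gen 27) proved THEOREM B⁺ from the far-side inequalities (FX), (FY) at the two
ports.  Parts XVII–XXIII (this generation) discharge them: (FX)/(FY) hold for EVERY far side, given only the two far stars
`E₃({u~v},{u~b},{u~c} in Rᶜ) ≥ 0`, `E₃({v~u},{v~b},{v~c} in Rᶜ) ≥ 0` (`IncStarTwoCut.FXCert.fx_far_row`, `fy_far_row`: exact q-uniform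
certificates = four-functions + BHK Thm 1.1 + Harris + the two stars, kernel-checked).  Hence

**THEOREM B⁺** (`incStar_nonneg_of_twoCut_farStars`).  Bond percolation `prodBernoulli w` on `Fin n`; a root side `R ∋ s`; two vertices
`u ≠ v` outside `R` such that no positive pair joins `R` to a vertex outside `R ∪ {u,v}`; targets `a ∈ R ∪ {u,v}` and `b, c ∉ R`; the
loner/separation events of the root side non-null.  IF the near star `E₃(Ba, Xu, Xv) ≥ 0` of the root-side events (an increasing star of
the weight restricted to the root-side pairs) and the two far stars at `u` and at `v` inside `Rᶜ` (increasing stars of the weight restricted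
to the far pairs) are nonnegative — all three inductively available —, THEN `E₃({s↔a},{s↔b},{s↔c}) ≥ 0`.
-/

noncomputable section

namespace Summit.CriticalPhenomena.PercolationContinuityZ3.Theorems

namespace IncStarTwoCut

open MeasureTheory Set Literature.Probability.Percolation Literature.Probability.LatticeModels
open IncStarOneTargetSide FourPointCert IncStarTwoCut.FXCert
open scoped Classical

variable {n : ℕ}

set_option maxHeartbeats 1600000 in
/-- **THEOREM B⁺ (two-cuts with the root and one target on the root side are reducible).**  Setting of part XIV
(`incStar_nonneg_of_twoCut_rootSideTarget_of_FX`) with `u, v ∉ R`; hypotheses: non-null loner/separation events on the root side, the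
near star `0 ≤ E₃(Ba, Xu, Xv)` of the root-side events, and the two FAR stars `0 ≤ E₃({u~v},{u~b},{u~c} in Rᶜ)`,
`0 ≤ E₃({v~u},{v~b},{v~c} in Rᶜ)`.  Conclusion: `0 ≤ E₃({s↔a},{s↔b},{s↔c})`.  ((FX), (FY) by `fx_far_row`, `fy_far_row` and (R1) at
the ports; then part XIV.) [this work] -/
theorem incStar_nonneg_of_twoCut_farStars (w : Sym2 (Fin n) → unitInterval) (R : Set (Fin n)) {s u v a b c : Fin n}
    (hs : s ∈ R) (ha : a ∈ R ∨ a = u ∨ a = v) (hb : b ∉ R) (hc : c ∉ R) (hu : u ∉ R) (hv : v ∉ R) (huv : u ≠ v)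
    (hw : ∀ x ∈ R, ∀ z, z ∉ R → z ≠ u → z ≠ v → w s(x, z) = 0)
    {F : Set (Sym2 (Fin n))} (hF : F = {e : Sym2 (Fin n) | ∃ y ∈ R, y ∈ e})
    {Xu Xv Ba : Set (BondConfig (Fin n))}
    (hXu : Xu = {ω | ω ∩ F ∈ (openConn s u : Set (BondConfig (Fin n)))})
    (hXv : Xv = {ω | ω ∩ F ∈ (openConn s v : Set (BondConfig (Fin n)))})
    (hBa : Ba = {ω | ω ∩ F ∈ (openConn s a : Set (BondConfig (Fin n)))})
    (hDu : 0 < (prodBernoulli w).real {ω | ω ∩ F ∈ ((openConn u s)ᶜ ∩ (openConn u v)ᶜ : Set (BondConfig (Fin n)))})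
    (hDv : 0 < (prodBernoulli w).real {ω | ω ∩ F ∈ ((openConn v s)ᶜ ∩ (openConn v u)ᶜ : Set (BondConfig (Fin n)))})
    (hD0 : 0 < (prodBernoulli w).real {ω | ω ∩ F ∈ ((openConn s u)ᶜ ∩ (openConn s v)ᶜ ∩ (openConn u v)ᶜ : Set (BondConfig (Fin n)))})
    (hNa : 0 ≤ sahiE3 (prodBernoulli w) Ba Xu Xv)
    (hSu : 0 ≤ sahiE3 (prodBernoulli w) (openConnIn Rᶜ u v) (openConnIn Rᶜ u b) (openConnIn Rᶜ u c))
    (hSv : 0 ≤ sahiE3 (prodBernoulli w) (openConnIn Rᶜ v u) (openConnIn Rᶜ v b) (openConnIn Rᶜ v c)) :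
    0 ≤ sahiE3 (prodBernoulli w) (openConn s a) (openConn s b) (openConn s c) := by
  have hmeas : ∀ X : Set (BondConfig (Fin n)), MeasurableSet X := fun _ => MeasurableSet.of_discrete
  have hus : u ≠ s := fun h => hu (h ▸ hs)
  have hvs : v ≠ s := fun h => hv (h ▸ hs)
  -- the far vertex set as a `Finset`
  obtain ⟨U, hUc⟩ : ∃ U : Finset (Fin n), (↑U : Set (Fin n)) = Rᶜ := ⟨(Set.toFinite Rᶜ).toFinset, Set.Finite.coe_toFinset _⟩
  have hlab : ∀ i < 4, lab u v b c i ∈ U := by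
    intro i hi
    rw [← Finset.mem_coe, hUc]
    interval_cases i
    · exact hu
    · exact hv
    · exact hb
    · exact hc
  rw [← hUc] at hSu hSv
  -- root-side events and numbers
  obtain ⟨Va, hVa⟩ : ∃ S : Set (BondConfig (Fin n)), S = {ω | ω ∩ F ∈ (openConn v a : Set (BondConfig (Fin n)))} := ⟨_, rfl⟩
  obtain ⟨Ua, hUa⟩ : ∃ S : Set (BondConfig (Fin n)), S = {ω | ω ∩ F ∈ (openConn u a : Set (BondConfig (Fin n)))} := ⟨_, rfl⟩
  obtain ⟨qX, hqX⟩ : ∃ r : ℝ, r = (prodBernoulli w).real (Xu \ Xv) := ⟨_, rfl⟩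
  obtain ⟨qY, hqY⟩ : ∃ r : ℝ, r = (prodBernoulli w).real (Xv \ Xu) := ⟨_, rfl⟩
  obtain ⟨qW, hqW⟩ : ∃ r : ℝ, r = (prodBernoulli w).real (Xu ∩ Xv) := ⟨_, rfl⟩
  obtain ⟨a0, ha0⟩ : ∃ r : ℝ, r = (prodBernoulli w).real (Ba ∩ (Xu ∪ Xv)ᶜ) := ⟨_, rfl⟩
  obtain ⟨aX, haX⟩ : ∃ r : ℝ, r = (prodBernoulli w).real (Ba ∩ (Xu \ Xv)) := ⟨_, rfl⟩
  obtain ⟨aY, haY⟩ : ∃ r : ℝ, r = (prodBernoulli w).real (Ba ∩ (Xv \ Xu)) := ⟨_, rfl⟩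
  obtain ⟨aW, haW⟩ : ∃ r : ℝ, r = (prodBernoulli w).real (Ba ∩ (Xu ∩ Xv)) := ⟨_, rfl⟩
  obtain ⟨dX, hdX⟩ : ∃ r : ℝ, r = (prodBernoulli w).real ((Ba ∪ Va) ∩ (Xu \ Xv)) - (prodBernoulli w).real (Ba ∩ (Xu \ Xv)) := ⟨_, rfl⟩
  obtain ⟨dY, hdY⟩ : ∃ r : ℝ, r = (prodBernoulli w).real ((Ba ∪ Ua) ∩ (Xv \ Xu)) - (prodBernoulli w).real (Ba ∩ (Xv \ Xu)) := ⟨_, rfl⟩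
  -- outside events and numbers
  obtain ⟨Pb, hPb⟩ : ∃ S : Set (BondConfig (Fin n)), S = openConnIn (↑U : Set (Fin n)) u b := ⟨_, rfl⟩
  obtain ⟨Qb, hQb⟩ : ∃ S : Set (BondConfig (Fin n)), S = openConnIn (↑U : Set (Fin n)) v b := ⟨_, rfl⟩
  obtain ⟨Pc, hPc⟩ : ∃ S : Set (BondConfig (Fin n)), S = openConnIn (↑U : Set (Fin n)) u c := ⟨_, rfl⟩
  obtain ⟨Qc, hQc⟩ : ∃ S : Set (BondConfig (Fin n)), S = openConnIn (↑U : Set (Fin n)) v c := ⟨_, rfl⟩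
  have hPbR : Pb = openConnIn Rᶜ u b := by rw [hPb, hUc]
  have hQbR : Qb = openConnIn Rᶜ v b := by rw [hQb, hUc]
  have hPcR : Pc = openConnIn Rᶜ u c := by rw [hPc, hUc]
  have hQcR : Qc = openConnIn Rᶜ v c := by rw [hQc, hUc]
  obtain ⟨ζ, hζ⟩ : ∃ r : ℝ, r = (prodBernoulli w).real (openConnIn (↑U : Set (Fin n)) u v) := ⟨_, rfl⟩
  have hζR : ζ = (prodBernoulli w).real (openConnIn Rᶜ u v) := by rw [hζ, hUc]
  obtain ⟨bx, hbx⟩ : ∃ r : ℝ, r = (prodBernoulli w).real Pb := ⟨_, rfl⟩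
  obtain ⟨by_, hby⟩ : ∃ r : ℝ, r = (prodBernoulli w).real Qb := ⟨_, rfl⟩
  obtain ⟨bU, hbU⟩ : ∃ r : ℝ, r = (prodBernoulli w).real (Pb ∪ Qb) := ⟨_, rfl⟩
  obtain ⟨bN, hbN⟩ : ∃ r : ℝ, r = (prodBernoulli w).real (Pb ∩ Qb) := ⟨_, rfl⟩
  obtain ⟨cx, hcx⟩ : ∃ r : ℝ, r = (prodBernoulli w).real Pc := ⟨_, rfl⟩
  obtain ⟨cy, hcy⟩ : ∃ r : ℝ, r = (prodBernoulli w).real Qc := ⟨_, rfl⟩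
  obtain ⟨cU, hcU⟩ : ∃ r : ℝ, r = (prodBernoulli w).real (Pc ∪ Qc) := ⟨_, rfl⟩
  obtain ⟨cN, hcN⟩ : ∃ r : ℝ, r = (prodBernoulli w).real (Pc ∩ Qc) := ⟨_, rfl⟩
  obtain ⟨mxx, hmxx⟩ : ∃ r : ℝ, r = (prodBernoulli w).real (Pb ∩ Pc) := ⟨_, rfl⟩
  obtain ⟨myy, hmyy⟩ : ∃ r : ℝ, r = (prodBernoulli w).real (Qb ∩ Qc) := ⟨_, rfl⟩
  obtain ⟨mU, hmU⟩ : ∃ r : ℝ, r = (prodBernoulli w).real ((Pb ∪ Qb) ∩ (Pc ∪ Qc)) := ⟨_, rfl⟩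
  obtain ⟨mN, hmN⟩ : ∃ r : ℝ, r = (prodBernoulli w).real ((Pb ∩ Qb) ∩ (Pc ∩ Qc)) := ⟨_, rfl⟩
  obtain ⟨bpx, hbpx⟩ : ∃ r : ℝ, r = (prodBernoulli w).real (Pb \ Qb) := ⟨_, rfl⟩
  obtain ⟨bpy, hbpy⟩ : ∃ r : ℝ, r = (prodBernoulli w).real (Qb \ Pb) := ⟨_, rfl⟩
  obtain ⟨cpx, hcpx⟩ : ∃ r : ℝ, r = (prodBernoulli w).real (Pc \ Qc) := ⟨_, rfl⟩
  obtain ⟨cpy, hcpy⟩ : ∃ r : ℝ, r = (prodBernoulli w).real (Qc \ Pc) := ⟨_, rfl⟩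
  -- class-law facts
  have hqX0 : 0 ≤ qX := by rw [hqX]; exact measureReal_nonneg
  have hqY0 : 0 ≤ qY := by rw [hqY]; exact measureReal_nonneg
  have hqW0 : 0 ≤ qW := by rw [hqW]; exact measureReal_nonneg
  have hxu : (prodBernoulli w).real Xu = qX + qW := by rw [hqX, hqW]; exact real_sdiff_add_inter Xu Xv
  have hxv : (prodBernoulli w).real Xv = qY + qW := by rw [hqY, hqW, Set.inter_comm]; exact real_sdiff_add_inter Xv Xu
  have hxuv : (prodBernoulli w).real (Xu ∪ Xv) = qX + qY + qW := by rw [hqX, hqY, hqW]; exact real_union_three Xu Xv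
  have upXu : IsUpperSet Xu := by rw [hXu]; exact isUpperSet_connF F s u
  have upXv : IsUpperSet Xv := by rw [hXv]; exact isUpperSet_connF F s v
  have hc' : (qX + qW) * (qY + qW) ≤ qW := by
    have h := prodBernoulli_harris w upXu upXv (hmeas _) (hmeas _)
    rw [hxu, hxv, ← hqW] at h; exact h
  have hq1 : qX + qY + qW ≤ 1 := by rw [← hxuv]; exact measureReal_le_one
  -- the far rows (FX), (FY)
  have kx := fx_far_row U u v b c w hlab hqX0 hqY0 hqW0 hq1 hc' hSu hSv hPb hQb hPc hQc
    hbx hby hbU hbN hbpx hbpy hcx hcy hcU hcN hcpx hcpy hmxx hmyy hmU hmN hζ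
  have ky := fy_far_row U u v b c w hlab hqX0 hqY0 hqW0 hq1 hc' hSu hSv hPb hQb hPc hQc
    hbx hby hbU hbN hbpx hbpy hcx hcy hcU hcN hcpx hcpy hmxx hmyy hmU hmN hζ
  -- (R1) at the ports `u` and `v`
  obtain ⟨Vu, hVu⟩ : ∃ S : Set (BondConfig (Fin n)), S = {ω | ω ∩ F ∈ (openConn v u : Set (BondConfig (Fin n)))} := ⟨_, rfl⟩
  obtain ⟨Uu, hUu⟩ : ∃ S : Set (BondConfig (Fin n)), S = {ω | ω ∩ F ∈ (openConn u u : Set (BondConfig (Fin n)))} := ⟨_, rfl⟩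
  obtain ⟨Vv, hVv⟩ : ∃ S : Set (BondConfig (Fin n)), S = {ω | ω ∩ F ∈ (openConn v v : Set (BondConfig (Fin n)))} := ⟨_, rfl⟩
  obtain ⟨Uv, hUv⟩ : ∃ S : Set (BondConfig (Fin n)), S = {ω | ω ∩ F ∈ (openConn u v : Set (BondConfig (Fin n)))} := ⟨_, rfl⟩
  have hUu' : Uu = Set.univ := by
    rw [hUu]; exact Set.eq_univ_of_forall fun ω => (SimpleGraph.Reachable.refl u : (openGraph (ω ∩ F)).Reachable u u)
  have hVv' : Vv = Set.univ := by
    rw [hVv]; exact Set.eq_univ_of_forall fun ω => (SimpleGraph.Reachable.refl v : (openGraph (ω ∩ F)).Reachable v v)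
  have su0 : (prodBernoulli w).real (Xu ∩ (Xu ∪ Xv)ᶜ) = 0 := by
    rw [show Xu ∩ (Xu ∪ Xv)ᶜ = ∅ from Set.eq_empty_of_forall_notMem fun ω h => h.2 (Or.inl h.1), measureReal_empty]
  have suX : (prodBernoulli w).real (Xu ∩ (Xu \ Xv)) = qX := by rw [hqX, Set.inter_eq_self_of_subset_right Set.sdiff_subset]
  have suY : (prodBernoulli w).real (Xu ∩ (Xv \ Xu)) = 0 := by
    rw [show Xu ∩ (Xv \ Xu) = ∅ from Set.eq_empty_of_forall_notMem fun ω h => h.2.2 h.1, measureReal_empty]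
  have suW : (prodBernoulli w).real (Xu ∩ (Xu ∩ Xv)) = qW := by rw [hqW, Set.inter_eq_self_of_subset_right Set.inter_subset_left]
  have sudX : (prodBernoulli w).real ((Xu ∪ Vu) ∩ (Xu \ Xv)) - (prodBernoulli w).real (Xu ∩ (Xu \ Xv)) = 0 := by
    rw [show (Xu ∪ Vu) ∩ (Xu \ Xv) = Xu \ Xv from Set.inter_eq_self_of_subset_right (Set.sdiff_subset.trans Set.subset_union_left),
      Set.inter_eq_self_of_subset_right Set.sdiff_subset, sub_self]
  have sudY : (prodBernoulli w).real ((Xu ∪ Uu) ∩ (Xv \ Xu)) - (prodBernoulli w).real (Xu ∩ (Xv \ Xu)) = qY := by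
    rw [hUu', Set.union_univ, Set.univ_inter, suY, sub_zero, hqY]
  have sv0 : (prodBernoulli w).real (Xv ∩ (Xu ∪ Xv)ᶜ) = 0 := by
    rw [show Xv ∩ (Xu ∪ Xv)ᶜ = ∅ from Set.eq_empty_of_forall_notMem fun ω h => h.2 (Or.inr h.1), measureReal_empty]
  have svX : (prodBernoulli w).real (Xv ∩ (Xu \ Xv)) = 0 := by
    rw [show Xv ∩ (Xu \ Xv) = ∅ from Set.eq_empty_of_forall_notMem fun ω h => h.2.2 h.1, measureReal_empty]
  have svY : (prodBernoulli w).real (Xv ∩ (Xv \ Xu)) = qY := by rw [hqY, Set.inter_eq_self_of_subset_right Set.sdiff_subset]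
  have svW : (prodBernoulli w).real (Xv ∩ (Xu ∩ Xv)) = qW := by rw [hqW, Set.inter_eq_self_of_subset_right Set.inter_subset_right]
  have svdX : (prodBernoulli w).real ((Xv ∪ Vv) ∩ (Xu \ Xv)) - (prodBernoulli w).real (Xv ∩ (Xu \ Xv)) = qX := by
    rw [hVv', Set.union_univ, Set.univ_inter, svX, sub_zero, hqX]
  have svdY : (prodBernoulli w).real ((Xv ∪ Uv) ∩ (Xv \ Xu)) - (prodBernoulli w).real (Xv ∩ (Xv \ Xu)) = 0 := by
    rw [show (Xv ∪ Uv) ∩ (Xv \ Xu) = Xv \ Xu from Set.inter_eq_self_of_subset_right (Set.sdiff_subset.trans Set.subset_union_left),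
      Set.inter_eq_self_of_subset_right Set.sdiff_subset, sub_self]
  have eu := twoCut_sahiE3_rootSide_eq w R hs (Or.inr (Or.inl rfl)) hb hc hw hF hXu hXv hXu hVu hUu hPbR hQbR hPcR hQcR
    hζR hqX hqY hqW su0.symm suX.symm suY.symm suW.symm sudX.symm sudY.symm hbx hby hbU hbN hcx hcy hcU hcN hmxx hmyy hmU hmN
  have ev := twoCut_sahiE3_rootSide_eq w R hs (Or.inr (Or.inr rfl)) hb hc hw hF hXu hXv hXv hVv hUv hPbR hQbR hPcR hQcR
    hζR hqX hqY hqW sv0.symm svX.symm svY.symm svW.symm svdX.symm svdY.symm hbx hby hbU hbN hcx hcy hcU hcN hmxx hmyy hmU hmN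
  -- (FX), (FY) in the form of part XIV
  have hFX : ((prodBernoulli w).real (openConnIn Rᶜ u b \ openConnIn Rᶜ v b) * (prodBernoulli w).real (openConnIn Rᶜ v c \ openConnIn Rᶜ u c)
      + (prodBernoulli w).real (openConnIn Rᶜ v b \ openConnIn Rᶜ u b) * (prodBernoulli w).real (openConnIn Rᶜ u c \ openConnIn Rᶜ v c))
      * ((1 - (qX + qW)) * (2 * qW - (qX + qW) * (qY + qW))) ≤ sahiE3 (prodBernoulli w) (openConn s u) (openConn s b) (openConn s c) := by
    rw [← hPbR, ← hQbR, ← hPcR, ← hQcR, ← hbpx, ← hbpy, ← hcpx, ← hcpy, eu]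
    linear_combination kx
  have hFY : ((prodBernoulli w).real (openConnIn Rᶜ u b \ openConnIn Rᶜ v b) * (prodBernoulli w).real (openConnIn Rᶜ v c \ openConnIn Rᶜ u c)
      + (prodBernoulli w).real (openConnIn Rᶜ v b \ openConnIn Rᶜ u b) * (prodBernoulli w).real (openConnIn Rᶜ u c \ openConnIn Rᶜ v c))
      * ((1 - (qY + qW)) * (2 * qW - (qX + qW) * (qY + qW))) ≤ sahiE3 (prodBernoulli w) (openConn s v) (openConn s b) (openConn s c) := by
    rw [← hPbR, ← hQbR, ← hPcR, ← hQcR, ← hbpx, ← hbpy, ← hcpx, ← hcpy, ev]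
    linear_combination ky
  exact incStar_nonneg_of_twoCut_rootSideTarget_of_FX w R hs ha hb hc hus hvs huv hw hF hXu hXv hBa hVa hUa hqX hqY hqW ha0 haX haY haW
    hdX hdY hDu hDv hD0 hNa hFX hFY

end IncStarTwoCut

end Summit.CriticalPhenomena.PercolationContinuityZ3.Theorems

end
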